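import Mathlib
import HarnessLib
import HarnessLib.Audit
import Summits.QuantumFields.Statement
import HarnessLib.Audit.Status.Attr

/-!
Route: WilsonMobilityGap

DORMANT since 2026-08-26T09:03:40Z (reconciler: no traction for 8.4 d (last activity item-evidence-added at 2026-08-17T23:00:09Z); parked, not closed — `ledger route dormant route-QuantumFields-WilsonMobilityGap --off` to reactivate) — unstaffed, not closed; items shared with open routes are served there. `ledger route dormant <id> --off` reactivates.

# Route WilsonMobilityGap — the Aoki boundary as a mobility edge — phase-quenched fractional-moment
localisation of the Wilson quark propagator makes the flavour-charged lattice gap kinematic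

It suffices to show X = K1 ∧ K2 ∧ K3 (card wilson-dirac-mobility-gap; absorbs the retired cards
quark-propagator-fractional-moments and
twisted-lattice-vafa-witten), RE-PINNED after the statement re-type of 2026-08-16 (p117723: `QCDOf
N_f := ∃ reg, HasMassScaling ∧
IsChiralAtZero ∧ ∀ m > 0, body`). K1 (CHIRAL MOBILITY GAP, item ChiralMobilityGap): for N_f = 2, 3
there is ONE mass-independent Wilson
regularisation reg (two-loop asymptotic scaling, leading-log Z_m) which is CHIRAL AT ZERO —
`reg.IsChiralAtZero`: for every ε > 0 some
positive mass tuple has no uniform lattice gap ε, i.e. m_crit(k) sits ON the chiral critical line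
(the Aoki boundary, where the mobility
edge λ_c of H_W = γ₅D_W reaches 0 — GoltermanShamir2003 §I) and not a physical offset M₀ above it —
such that for every positive mass tuple
m, along the bare trajectory m_f(k) = m_crit(k) + a_k m_f/Z_m(k), the flavour-f block of the quark
propagator G_U = D_W(U)⁻¹ between lattice
sites 0 and v has PHASE-QUENCHED fractional moments E_{|Π_f det D_W|}[‖G_f(0,v)‖₁^s] ≤ C e^(−δ a_k
‖v‖∞) on every torus of side
2S+1 ≥ 2L_k+1, uniformly in S (a mobility gap of the Hermitian Wilson–Dirac operator at physical
rate δ = δ(m), allowed to vanish as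
m → 0⁺), together with the honesty pins that make this non-vacuous: the same moments are ≥ c₀
(n+1)^(−p) e^(−C₁ a_k n) along the time
axis (quarks are not lattice-heavy), bare masses stay > −1, and the signed fermion weight is
coherent at the scheme's own volume,
|∫Π_f det| ≥ ½ ∫|Π_f det| (sign defects = real-mode crossings are dilute). K2 (KINEMATIC HALF, item
PhaseQuenchedFlavourDecay, unchanged):
for any regularisation and masses, the K1 upper bound alone forces every flavour-CHARGED
gauge-invariant local observable (all flavoured
mesons, all baryons, any quark box) to have phase-quenched Euclidean-time correlators decaying at a
physical rate uniformly in the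
volume. K3 (CHIRAL GLUONIC COMPLETION, item ChiralGluonicCompletion, the Yang–Mills-hard remainder):
a regularisation carrying the pinned
package K1 ∧ K2 — chirality at zero INCLUDED as an input — can be completed to QCDOf N_f (signed
measure, flavour-neutral and gluonic
channels, continuum limit with E0–E4, non-triviality) WITHOUT shifting the flavour-blind offset. The
pre-re-type items MobilityGap (K1
without pin (v)) and GluonicCompletion (K3 without the chiral input) stay in the route as supports:
ChiralMobilityGap → MobilityGap and
GluonicCompletion → ChiralGluonicCompletion are one line each (planner's Sketch.lean, rc 0), so
every lemma banked on them transfers.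
Frame: no separate target (X is the conjunction of the three cruxes); the deciding theorem closes :
ChiralMobilityGap →
PhaseQuenchedFlavourDecay → ChiralGluonicCompletion → QCD is propositional bookkeeping (natively
certified).
Lean: `ChiralMobilityGap ∧ PhaseQuenchedFlavourDecay ∧ ChiralGluonicCompletion`

## Assembly
Pure logic (sorry-free in the planner's Sketch.lean and in glue.lean): QCD = QCDOf 2 ∧ QCDOf 3; for
N_f ∈ {2,3} ChiralMobilityGap yields
reg with HasMassScaling, IsChiralAtZero, asymptotic scaling and, for each m > 0, clauses (i)–(iv);
PhaseQuenchedFlavourDecay applied to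
(reg, m) and clause (ii) yields the flavour-charged phase-quenched decay; ChiralGluonicCompletion
consumes exactly this pinned package and
returns QCDOf N_f (whose witness regularisation must itself be chiral at zero — the completion keeps
m_crit, or re-proves the pin for
whatever subsequence it passes to). All predicate texts are generated from one template, the two
pinned items by inserting
`reg.IsChiralAtZero ∧` after `reg.HasMassScaling ∧` in the texts of MobilityGap / GluonicCompletion,
so the hypotheses of #3/#4 are
syntactically the conclusions of #2/#3.

Rationale: WHY THIS LINE. The positive quark mass IS a spectral gap of the continuum Dirac Hamiltonian γ₅(D̸+m)
(VafaWitten1984NPB, Weingarten1983), but Wilson's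
D_W is non-normal and full-support Haar links put real modes inside the gap at every spacing
(EdwardsHellerNarayanan1998; the support item
SupercriticalSignWitness), so "uniform gap of the massive Wilson operator" is false and
hopping/Neumann series stop at κ = 1/8
(Literature.Barriers.QuantumFields.HoppingExpansionLocality). Golterman–Shamir (GoltermanShamir2003,
GoltermanShamirSvetitsky2005) read
H_W = γ₅D_W on the gauge ensemble as a disordered Hamiltonian with a MOBILITY EDGE, the Aoki phase
being λ_c = 0; we transplant the rigorous
band-gap localisation technology of random Schrödinger operators — Aizenman–Molchanov fractional
moments and finite-volume criteria
(doi:10.1007/bf02099760, doi:10.1007/s002200100441), Lifshitz-tail/band-edge multiscale analysis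
(doi:10.1007/s00220-002-0727-y), the
eigenfunction-correlator upgrade (Aizenman–Warzel, GSM 168, Ch. 7) — with the explicit dictionary
random potential ↦ staple-conditioned
Haar links, Wegner estimate ↦ Haar-regularity of single-link conditionals, Lifshitz tail ↦
dislocation action (Luscher1982Topology), in-gap
state ↦ real-mode crossing = sign defect (MohlerSchaefer2020,
Literature.Barriers.QuantumFields.WilsonDeterminantSign). New relative to
the card: the weight is the phase-quenched |Π_f det D_W|, under which exactly the per-flavour MINORS
of G are integrable (Jacobi), so the
"Weingarten domination" step becomes a determinantal-localisation statement (K2) and the sign of the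
honest weight is isolated as a
dilute defect gas handed to the gluonic completion (K3); no prior route exists on QCD and the
negatives index is empty. RE-TYPE 2026-08-16 (p117723, `QCDOf` gained `reg.IsChiralAtZero`): the
chiral pin is one more HONESTY PIN on K1's own regularisation —
in the mobility-edge dictionary it says m_crit(k) is the λ_c = 0 line itself ("Outside the Aoki
phase [the mobility edge] is larger than zero …
When one moves closer to the phase transition, the mobility edge comes down continuously, until it
vanishes", GoltermanShamir2003 §I, p. 3),
not a physical offset above it (the upward shift m_crit ↦ m_crit + a_k M₀/Z_m that the old statement
tolerated, `scheme_mcrit_shift` /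
`qcdOf_iff_threshold` of Theorems/GluonicCompletion/Negative/Threshold.lean) — and K3 must CONSUME
the pin instead of re-deriving the chiral
limit on its own: hence the pinned items ChiralMobilityGap (K1 + pin (v)) and
ChiralGluonicCompletion (K3 with the pin as input), the new
deciding theorem over them, and the demotion of the unpinned MobilityGap / GluonicCompletion to
supports (one-line implications either way
round, so all banked lemmas and both crux dossiers transfer).

RANKED CRUXES. #2 ChiralMobilityGap (crux) — K1 with the chiral pin (v) (statement re-type p117723).
For N_f ∈ {2,3} there is reg : QCDRegularisation N_f with HasMassScaling, reg.IsChiralAtZero (for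
every ε > 0 some positive mass tuple m has NO uniform lattice gap ε along reg.scheme m 0 0: the
lattice gap closes as m → 0⁺, which pins the flavour-blind offset of m_crit to the chiral point =
the Aoki boundary / λ_c = 0 line at every large k, to o(a_k/Z_m(k)) in lattice units) and two-loop
asymptotic scaling such that for every m > 0 (componentwise), along m_f(k) = m_crit(k) + a_k
m_f/Z_m(k), clauses (i) BRANCH, (ii) UPPER (phase-quenched fractional-moment localisation at
physical rate δ(m) > 0, uniformly in the volume), (iii) LOWER (quarks not lattice-heavy) and (iv)
SIGN (coherence at the scheme's own side) hold VERBATIM as in MobilityGap below. The Lean text is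
MobilityGap's with `reg.IsChiralAtZero ∧` inserted after `reg.HasMassScaling ∧` (the order of
QCDOf). [difficulty: open-problem] (why it might fail: everything under MobilityGap, now for
ARBITRARILY LIGHT quarks — δ(m) → 0 is allowed but (ii) and (iv) must hold at every fixed m > 0 as
a_k → 0 right down to the edge where GS2003 have λ_c → 0 and near-zero modes delocalise; and the pin
itself needs a LOWER bound on a flavour-charged correlator at small m (lattice Goldstone/GMOR:
m_π(m) → 0), for which no rigorous tool exists at weak coupling; in the first-order branch of the
Aoki dichotomy (SharpeSingleton1998, c₂ < 0) the minimal pion mass at step k is O(a_k) ≠ 0, so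
m_crit(k) must track the transition line to that accuracy.) [GoltermanShamir2003,
GoltermanShamirSvetitsky2005MobilityEdge, SharpeSingleton1998, MontvayMunster1994,
AizenmanMolchanov1993, AizenmanEtAl2001, Klopp2002, MohlerSchaefer2020, Luscher1982Topology]
#3 PhaseQuenchedFlavourDecay (crux) — card K2, phase-quenched and determinantal. For every N_f,
every reg : QCDRegularisation N_f and every m > 0: the UPPER clause of MobilityGap alone implies
that there is δ' > 0 such that for every pair of gauge-invariant local lattice QCD observables A, B
(any quark boxes) with A FLAVOUR-CHARGED (some flavour f₀ and q ≠ 0 with A ↦ e^(iqθ)A under ψ_f₀ ↦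
e^(iθ)ψ_f₀, ψ̄_f₀ ↦ e^(−iθ)ψ̄_f₀) there is C' with, for all large k, all S ≥ L_k and n ≤ S,
|E_{|w|}[⟨A(0)·B(n e₀)⟩_F(U)]| ≤ C' e^(−δ' a_k n), ⟨·⟩_F(U) the Berezin ratio in the background U
(charged A has ⟨A⟩_F ≡ 0, so this IS the connected correlator of the phase-quenched ensemble).
Mechanism: Wick's theorem in determinant form — ⟨AB⟩_F·Π_f det D_f is a sum of products of
COMPLEMENTARY MINORS of the D_f (Jacobi), bounded configuration-wise, and flavour charge forces ≥
|q| quark lines of flavour f₀ across the separation in every term; the upgrade from single-entry s<1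
moments to first moments of minors is the lattice analogue of the eigenfunction-correlator /
determinantal-decay step of localisation theory. [deps: ChiralMobilityGap (clause (ii) only;
MobilityGap's (ii) is the same text)] [difficulty: L] (why it might fail: in Anderson theory E|G|^s
(s<1) decays while E|G|² is infinite (resonance tails); here |Πdet| regularises poles only up to
per-flavour minors, so joint s=1 minor moments need a genuinely new decoupling argument, not Hölder
from single-entry bounds.) [Weingarten1983, VafaWitten1984NPB, doi:10.1007/s00220-016-2612-0,
doi:10.1007/s00220-018-3121-0, doi:10.1090/gsm/168, MontvayMunster1994]
#4 ChiralGluonicCompletion (crux) — K3 with the chiral pin as INPUT (statement re-type p117723). For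
N_f ∈ {2,3}: if some reg : QCDRegularisation N_f has HasMassScaling, reg.IsChiralAtZero, asymptotic
scaling and, for every m > 0, clauses (i)–(iv) of MobilityGap together with the conclusion of
PhaseQuenchedFlavourDecay, then QCDOf N_f holds — i.e. such a CHIRAL, localised, sign-coherent,
flavour-gapped Wilson trajectory can be completed to OS data with IsQCDAlong, non-trivial
non-Gaussian glue, non-decoupled flavour-changing pseudoscalars, T.HasMassGap Δ and the FULL
HasLatticeMassGap Δ for every m > 0, by a witness regularisation that is ITSELF chiral at zero: the
completion may choose z, shift (IsChiralAtZero reads reg.scheme m 0 0 only), keep reg, or pass to a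
subsequence that retains the chiral witnesses (countably many (ε_j, m_j), a diagonal choice) — but
it may NO LONGER shift the flavour-blind offset. The Lean text is GluonicCompletion's with
`reg.IsChiralAtZero ∧` inserted after `reg.HasMassScaling ∧` in the hypothesis; GluonicCompletion →
ChiralGluonicCompletion is one line. [deps: ChiralMobilityGap, PhaseQuenchedFlavourDecay]
[difficulty: open-problem] (why it might fail: as GluonicCompletion — uniform gluonic clustering at
weak coupling, a convergent sign-defect expansion, E0–E4 with rotations, non-Gaussian glue are each
open — and now without the offset shift: signed = phase-quenched reweighting and the continuum limit
must be controlled at the given m_crit for every m > 0, i.e. arbitrarily close to the chiral line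
where ⟨σ⟩_{|w|} and the charged gap δ'(m) degrade together.) [JaffeWitten2000,
Balaban1988Convergent, OsterwalderSeiler1978, Luscher1977, MohlerSchaefer2020, SeilerLNP1982,
GoltermanShamir2003]
#9 MobilityGap (support; crux #2 until the re-type) — the UNPINNED K1, text unchanged in the route
file (item stmt-QuantumFields-9150: its skeletons, Negative/LowerPin lemmas and sibling reduction
stay attached): ∃ reg with HasMassScaling and asymptotic scaling such that for every m > 0 clauses
(i) −1 < m_f(k) eventually, (ii) UPPER E_{|w|}[(Σ|G_f(0,v)|)^s] ≤ C e^(−δ a_k ‖v‖∞) for all S ≥ L_k,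
v ∈ {−S..S}⁴, (iii) LOWER c₀ e^(−C₁ a_k n − p log(n+1)) ≤ E_{|w|}[(Σ|G_f(0,n e₀)|)^s], (iv) SIGN
|∫Πdet dμ_W| ≥ ½∫|Πdet| dμ_W at side 2L_k+1. ChiralMobilityGap → MobilityGap drops pin (v): a proof
is the above-offset milestone and every lemma banked on it transfers to #2. [difficulty:
open-problem] [GoltermanShamir2003, GoltermanShamirSvetitsky2005, AizenmanMolchanov1993,
AizenmanEtAl2001, Klopp2002, Luscher1982Topology, MohlerSchaefer2020, DebbioEtAl2006]
#9 GluonicCompletion (support; crux #4 until the re-type; SHARED with route PauliWegnerSea) — the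
completion WITHOUT the chiral input, text unchanged (item stmt-QuantumFields-9152): (∃ reg with
HasMassScaling, asymptotic scaling and, ∀ m > 0, clauses (i)–(iv) + the flavour-charged decay) →
QCDOf N_f. Under the re-typed QCDOf its hypothesis no longer carries what its conclusion needs (the
chiral pin; the hypothesis is invariant under the upward m_crit shift, the conclusion is not), so in
THIS route it is superseded as a hypothesis of closes by #4; it is the STRONGER statement
(GluonicCompletion → ChiralGluonicCompletion), so any proof of it still closes #4. [difficulty:
open-problem] [JaffeWitten2000, Balaban1988Convergent, OsterwalderSeiler1978, Luscher1977,
MohlerSchaefer2020, SeilerLNP1982]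
#9 SupercriticalSignWitness (support) — card P1 in finite form (the source of in-gap states and sign
defects; records why no deterministic-gap crux can work): for every bare mass m ∈ (−1, 0) there are
a torus and an SU(3) gauge field on it with Re det D_W(U, m, r=1) < 0 (one real mode of D_W(U,0,1)
in (0, |m|): a sufficiently smooth lattice instanton on a large enough torus; EHN report the first
crossing at |m| = 0.41 for ρ = 2a). Provable by a certified interval computation of one determinant
sign per m-interval plus continuity, or analytically for large smooth instantons. [difficulty: M]
[EdwardsHellerNarayananInstanton1998, EdwardsHellerNarayanan1998, Luscher1982Topology]
#9 WegnerEstimate (support) — SHARED with the sibling route SpectralDefectExtinction (its crux #4,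
filed there "shared with card wilson-dirac-mobility-gap"; re-asked here verbatim so the item
attaches to both routes): the quenched base case of the Wegner input of (Chiral)MobilityGap's
multiscale / fractional-moment scheme — there are C, p such that for every β ≥ 1, every torus side L
≥ 2, every bare mass m₀ ∈ [−1, 0] and every ε ∈ (0, 1], the Wilson-measure expectation of the number
of eigenvalues of the Hermitian Wilson–Dirac operator γ₅D_W(U, m₀, 1) in (−ε, ε) is ≤ C(1+β^p)·ε·L⁴
(density of states linear in the window, extensive, polynomial in β). K1 needs its phase-quenched,
boxed analogue; this is the first rung. [difficulty: L] [Wegner1971, GoltermanShamir2003,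
doi:10.1007/s00023-012-0177-9, doi:10.1063/1.4959219]
#1 Assembly (assembly) — restated to the re-pinned conjunction ChiralMobilityGap ∧
PhaseQuenchedFlavourDecay ∧ ChiralGluonicCompletion → QCD (the uncurried deciding theorem; re-prove
by REPLACING Theorems/WilsonMobilityGapAssembly.lean, whose current text applies the pre-re-type
`closes` and no longer compiles once this edit lands — expected breakage of the re-type, same class
as the dependents listed in docs/m5/audits/retype-2026-08-16/qcd/REPORT.md).

TWO-LAYER PLAN. Foreseen glued splits (none filed now): ChiralMobilityGap ⇐ TrajectoryLocalisation
(clauses i–iii for a scheme with L_k free: finite-volume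
fractional-moment criterion for staple-conditioned Haar-link disorder, fed by the phase-quenched
analogue of the support item WegnerEstimate + an initial-scale bound from the dislocation action) →
SignDefectDilution
(clause iv: the density of real modes of D_W(U,0) below −m_f(k) vanishes in physical units, S_disl ·
b₀ > 1 in the tree's normalisation
β = 2/g₀²) → EdgeGaplessness (pin (v): along the SAME reg, for every ε a degenerate light tuple m =
(t,…,t) has a flavour-charged (pion) correlator decaying slower than e^(−ε a_k n) frequently in k —
a LOWER bound, the lattice face of m_π² ∝ m; it cannot be split off as an independent item because
it concerns K1's own ∃-witness, so it rides as the last child of the glued split) →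
ChiralMobilityGap (the unpinned support MobilityGap is the conjunction of the first two children up
to the shared witness). PhaseQuenchedFlavourDecay ⇐ MinorMoments (first moments of per-flavour
minors of G decay under |w| given UPPER)
→ WickCharge (flavour charge forces a crossing line in every determinant-form Wick term; bookkeeping
on QCDLatticeObservable) →
PhaseQuenchedFlavourDecay. GluonicCompletion ⇐ SignedReweighting (signed = phase-quenched up to
e^(−δ a n) for flavour-charged channels,
given gluonic clustering of |w|) → NeutralSectorAndContinuum (the Yang–Mills core) →
GluonicCompletion.

KILL CRITERIA. Refutation of ChiralMobilityGap through its pin — a theorem that NO admissible Wilson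
regularisation with clauses (i)–(iv) for all m > 0 can be chiral at zero (e.g. localisation (ii) at
every m > 0 forcing a lattice gap bounded below uniformly in m) — closes the route
`refuted:ChiralMobilityGap` and is news for every Wilson route (the re-typed QCDOf demands exactly
such a reg); a refutation of the unpinned support MobilityGap refutes #2 a fortiori. Refutation of
MobilityGap/ChiralMobilityGap by exhibiting, at weak coupling, EXTENDED in-gap modes of H_W at
physical supercritical masses (inverse
participation ratios not shrinking with volume) or a proof that clause (iv) fails for N_f = 3
(sign-defect density positive in physical
units along every asymptotically scaling Wilson trajectory) closes the route `refuted:MobilityGap` —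
the second would also be a theorem
about every Wilson-fermion route to QCDOf 3. Refutation of PhaseQuenchedFlavourDecay (single-entry
fractional localisation without decay
of minor moments, e.g. a resonance mechanism surviving the |det| weight) forces a pivot: restate K1
directly for minors. A proof of
YangMills plus a robust-perturbation theorem elsewhere moots ChiralGluonicCompletion (and the
support GluonicCompletion); a refutation of QCDOf 3 itself moots everything.

NOT DECOMPOSED YET. The Wegner/Haar-regularity lemma and the initial-scale (dislocation) estimate
inside (Chiral)MobilityGap; the EdgeGaplessness child (pin (v)) — typed only inside #2 because it
speaks of #2's own witness (a free-standing "∀ reg, package → IsChiralAtZero" is FALSE by the upward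
m_crit shift, `scheme_mcrit_shift`, as soon as a gapped witness exists, and "∀ reg, package → ∃
chiral reg' with the package" merely re-asks #2); the finite-volume criterion constants;
the Wick/charge bookkeeping on QCDLatticeObservable and the Jacobi complementary-minor identity for
diracMatrix (layer-2 children of
PhaseQuenchedFlavourDecay, to be attached with --supports); the quenched (pure Wilson measure) toy
version of K1; the twisted-mass rung
ω > 0 where K1 is configuration-wise (card P2) — QCDOf hard-wires untwisted Wilson quarks, so it is
commentary, not an item; everything
gluonic (K3) until K1 moves; a tenure pass may DROP the two unpinned supports once their dossiers
have migrated to #2/#4.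

CHEAPEST FALSIFIER. For the new pin (v): in-Lean first — try to derive ¬IsChiralAtZero from clauses
(i)–(iv) ∀ m > 0 alone (if (ii)–(iii) with m-uniform constants were derivable the pin would
contradict them; they are not: s, δ, C, c₀, C₁ sit inside ∀ m); numerically, the pion mass along
lines of constant a·m/Z on existing N_f = 2 Wilson ensembles must extrapolate to 0 at κ_c(β) with
m_π² ∝ m (standard, e.g. DebbioEtAl2006) — a plateau m_π → c·a⁻¹ at κ_c would kill every Wilson
regularisation's chirality at that β, and a plateau in PHYSICAL units surviving a → 0 would kill the
re-typed statement itself. Numerics first (kit, not run here — the hub is compute-free and this is a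
one-shot plancard): exact low modes of H_W = γ₅D_W(m) on quenched
SU(3) (even SU(2)) 8⁴–12⁴ Wilson ensembles at two β on a line of constant a·m, bare mass just above
κ_c(β): (a) inverse participation
ratios of in-gap modes vs volume (extended in-gap modes outside the Aoki phase kill K1;
Golterman–Shamir–Svetitsky report localised),
(b) the fraction of configurations with an odd number of real modes of D_W(U,0) below −m at fixed
physical volume vs β (must fall fast:
Mohler–Schaefer see 2% → 0.05% from β = 3.4 to 3.7 on CLS N_f = 2+1). Theory-side lookup: a
published Wegner estimate for OFF-DIAGONAL
unitary (Haar-link) disorder — none found; if the single-link conditional density constant e^(cβ)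
provably cannot be dominated by the
dislocation exponent, the multiscale scheme is void at weak coupling.

NUMBERS. Tree normalisation β = 2/g₀² (= β_W/3 for SU(3)); b₀ = (11 − 2N_f/3)/(16π²); clause (iv) in
physical units needs dislocation action
S_disl > 1/b₀ = 16π²/9 ≈ 17.5 for N_f = 3 against the instanton value 4π² ≈ 39.5 in the same units
(ratio 4/9). Gap-edge numerics:
median spectral gap of |γ₅D_W| ∝ Z_A a m, width ∝ a/√V (DGLPT 2006,
doi:10.1088/1126-6708/2006/02/011). Negative strange determinants on
CLS ensembles: ≈2% (β=3.4, 3.46), 0.3% (3.55), 0.05% (3.7) (MohlerSchaefer2020 §4.2). EHN: first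
real-mode crossing of a ρ = 2a instanton
at |m| = 0.411; m₁(β=5.7) = 1.02 decreasing towards weak coupling. Items at open: 6 (3 cruxes, 2
supports, 1 assembly); after the re-type repair (2026-08-16): 8 (3 cruxes ChiralMobilityGap r2 /
PhaseQuenchedFlavourDecay r3 / ChiralGluonicCompletion r4, 4 supports MobilityGap /
GluonicCompletion / WegnerEstimate / SupercriticalSignWitness, 1 assembly).

DEFINITION REQUESTS. To be filed after open (statements are inlined now, so nothing blocks):
`qcdPhaseQuenchedExpect β S mq φ` (the |det diracMatrix|-reweighted
Wilson expectation E_{|w|} used in #2–#4), `QCDLatticeObservable.IsFlavourCharged` (U(1)_f rephasing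
of the boxed Grassmann algebra via
ExteriorAlgebra.map, as inlined in #3), `quarkPropagatorBlock` (the colour–spin block of
diracMatrix⁻¹ between two sites); topic
Literature/MathematicalPhysics/QuantumFieldTheory. A tenure pass can then restate #2–#4 compactly
(same meaning).

Novelty: Searches (2026-08-15, this planner; the card's own searches are in the card): `lit search "Anderson
localization Wilson Dirac operator lattice gauge mobility edge" -n 15` (local 9 held, all physics:
GoltermanShamir2003 = arxiv-hep-lat_0306002, GSS doi:10.1103/physrevd.72.034501, finite-T QCD
Anderson transition numerics arXiv:1312.3286, arXiv:2104.14388, arXiv:2206.11109, arXiv:2304.13617;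
remote 28: no theorem); `lit search --source crossref "localization gapped Dirac Hamiltonian random
perturbations fractional moment"` (doi:10.4171/dm/675, doi:10.1063/5.0078383 — scalar potential);
`lit search --source crossref "Anderson localization random magnetic field Wegner estimate …"`
(doi:10.1007/s00220-011-1373-z, doi:10.1007/s00023-012-0177-9, doi:10.1063/1.4959219 — ABELIAN link
disorder only); `lit search --source zbmath "localization random non-abelian gauge potential"` (2:
Ichinose 2002 doi:10.1142/s021773230200779x, physics); `lit search --source arxiv "Anderson
localization non-abelian gauge disorder SU(2) random link"` (0); `lit search --source crossref "Sims
Warzel determinantal …"` (doi:10.1007/s00220-016-2612-0, doi:10.1007/s00220-018-3121-0: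
determinantal decay for FREE fermions given one-particle localisation — the template of #3, never
applied to a gauge-covariant Dirac operator); `lit galaxy search "mobility edge Wilson" --star all`
(0) and `lit galaxy search "fractional moment method" --star all` (13: ASFH math-ph/9910022,
Chulaevsky–Suhov multi-particle MSA, Elgart  [refs: 10.1103/physrevd.72.034501, 10.4171/dm/675, 10.1063/5.0078383, 10.1007/s00220-011-1373-z, 10.1007/s00023-012-0177-9, 10.1063/1.4959219, 10.1142/s021773230200779x, 10.1007/s00220-016-2612-0, 10.1007/s00220-018-3121-0:, 10.1103/physrevd.68.074501:, 10.1007/s00220-018-3121-0, 10.1090/gsm/168, 10.1007/bf02099760, 10.1007/s002200100441, 1312.3286, 2104.14388, 2206.11109, 2304.13617, 1011.5648, hep-lat/]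

Barriers (technique_class: random-operator-localisation, fractional-moments): - technique_class: random-operator-localisation, fractional-moments
- Literature.Barriers.QuantumFields.VafaWittenEigenvalueBound: evaded as its evasions_known print —
all masses positive (m_f > 0 throughout; since the re-type the offset is PINNED to the chiral point
by pin (v) = reg.IsChiralAtZero, but (v) asserts gap CLOSURE at small m — an upper bound on the
lattice gap — never a bound obtained through a gap of the massless operator), no gap of the massless
operator is used, and not even a uniform gap of the massive Wilson operator is claimed
(SupercriticalSignWitness concedes in-gap real modes); only fractional-moment decay.
- Literature.Barriers.QuantumFields.BanksCasherCriterion: not in class (ii): no volume-uniform ‖D⁻¹‖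
bound is asserted; the near-edge modes at ±Z a m may stay extended (consistent with Σ ≠ 0); m → 0⁺
enters only through pin (v), which asserts the ABSENCE of a uniform lattice gap at small positive
masses — the barrier obstructs exhibiting Σ ≠ 0 by class-(i)/(ii) techniques, and (v) indeed needs a
LOWER bound on a flavour-charged correlator near the chiral line for which #2 commits to no
technique yet (conceded: the open part of ChiralMobilityGap; the thermodynamic limit S ≥ L_k, a_k
L_k → ∞ is built into HasLatticeMassGap, so volume-before-mass is automatic).
- Literature.Barriers.QuantumFields.HoppingExpansionUniformGap: no Neumann/hopping series — the
trajectory sits at κ > 1/8 eventually (bare masses → m_crit(k) < 0), where background-uniform conver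

History (route lifecycle, newest last):
- 2026-08-15T16:48:41Z · rev 5: restated Assembly (stmt-QuantumFields-9154) — route-repair (cone, gen 3): rerouted = nothing to re-route. 0 own imports (only the gate preamble), 0 cruxes restated, 0 of the 5 flagged facts needed. Native c (planner-rrepair-QuantumFields-WilsonMobilityGa-effe8e09-g3-0)
- 2026-08-16T23:22:22Z · rev 8: restated Assembly (stmt-QuantumFields-11071 proved) — route-repair (statement-revised p117723), part C: restate Assembly (11071, statement MobilityGap ∧ PhaseQuenchedFlavourDecay ∧ GluonicCompletion → QCD — still t (planner-rrepair-QuantumFields-WilsonMobilityGa-6862f17d-0)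
- 2026-08-26T09:03:40Z · DORMANT — reconciler: no traction for 8.4 d (last activity item-evidence-added at 2026-08-17T23:00:09Z); parked, not closed — `ledger route dormant route-QuantumFields-Wi (operator:999:2822663)

sub-problem: QCD · status: dormant · opened planner-plancard-QuantumFields-QCD-wilson-dir-87afebf8-0 2026-08-15T13:51:14Z · rev 8 · ledger route-QuantumFields-WilsonMobilityGap
GENERATED by the gate from the ledger (D-0016/17). Provers cite these decls: `theorem foo : Summit.QuantumFields.QCD.Theses.WilsonMobilityGap.<Decl> := …` in Summits/QuantumFields/QCD/Theorems/<Name>.lean.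
-/

namespace Summit.QuantumFields.QCD.Theses.WilsonMobilityGap

open scoped BigOperators Topology Manifold Classical MeasureTheory ProbabilityTheory Matrix InnerProductSpace ComplexConjugate ContinuousMap
open Filter Set Function TopologicalSpace MeasureTheory

attribute [summit_statement] _root_.QCD

/-- item stmt-QuantumFields-17497 · crux · rank 2 · open · by planner
why it might fail: Pin (v) forces (ii)+(iv) for arbitrarily light quarks, down to the edge where GS2003 have λ_c→0 and near-zero modes delocalise, AND a provable gap CLOSURE there (LOWER bound on the charged-pion correlator, lattice GMOR: no rigorous tool at weak coupling); plus MobilityGap's Wegner start-up problem.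
sources: GoltermanShamir2003, GoltermanShamirSvetitsky2005MobilityEdge, SharpeSingleton1998, MontvayMunster1994, AizenmanMolchanov1993, AizenmanEtAl2001
[crux] K1 with the chiral pin (v) (statement re-type p117723: QCDOf gained reg.IsChiralAtZero). For
N_f ∈ {2,3} there is reg : QCDRegularisation N_f with HasMassScaling, reg.IsChiralAtZero (for every
ε > 0 some positive mass tuple has NO uniform lattice gap ε along reg.scheme m 0 0 — the lattice gap
closes as m → 0⁺, so m_crit(k) is the chiral critical line = the Aoki boundary / mobility-edge-zero
line of H_W = γ₅D_W at β_k, not a physical offset above it) and two-loop asymptotic scaling such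
that for every m > 0 (componentwise), along m_f(k) = m_crit(k) + a_k m_f/Z_m(k): (i) −1 < m_f(k)
eventually; (ii) UPPER: ∃ s ∈ (0,1), δ, C > 0 with, for all large k, all S ≥ L_k, all flavours f and
all v ∈ {−S..S}⁴, E_{|w|}[(Σ_{colour,spin}|G_f(0,v)|)^s] ≤ C e^(−δ a_k ‖v‖∞) (E_{|w|} = Wilson
measure at β_k on the torus of side 2S+1 reweighted by |det diracMatrix| = Π_f|det D_W(m_f(k))|, G =
diracMatrix⁻¹; δ = δ(m) may vanish as m → 0⁺); (iii) LOWER: ∃ s, c₀, C₁, p with c₀ e^(−C₁ a_k n − p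
log(n+1)) ≤ E_{|w|}[(Σ|G_f(0, n e₀)|)^s] for n ≤ S; (iv) SIGN: for all large k, |∫ det diracMatrix
dμ_W| ≥ ½ ∫ |det diracMatrix| dμ_W on the torus of side 2L_k+1. Text = MobilityGap's with
`reg.IsChiralAtZero -/
@[route_item "route-QuantumFields-WilsonMobilityGap", crux]
def ChiralMobilityGap : Prop :=
  open MeasureTheory Filter Literature.MathematicalPhysics.QuantumFieldTheory Literature.MathematicalPhysics.QuantumLattice Literature.Probability.LatticeModels in ∀ Nf : ℕ, Nf = 2 ∨ Nf = 3 → ∃ reg : QCDRegularisation Nf, reg.HasMassScaling ∧ reg.IsChiralAtZero ∧ (reg.scheme 0 0 0).HasAsymptoticScaling ∧ ∀ m : Fin Nf → ℝ, (∀ f, 0 < m f) → (∀ f : Fin Nf, ∀ᶠ k in atTop, -1 < reg.mcrit k + reg.a k * m f / reg.Zm k) ∧ (∃ s δ C : ℝ, 0 < s ∧ s < 1 ∧ 0 < δ ∧ ∀ᶠ k in atTop, ∀ S : ℕ, reg.L k ≤ S → ∀ (f : Fin Nf) (v : Literature.Probability.LatticeModels.Site 4), v ∈ box 4 S → (∫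 U : GaugeConfig 4 (2 * S + 1) (Matrix.specialUnitaryGroup (Fin 3) ℂ), ‖(diracMatrix U fun fl => reg.mcrit k + reg.a k * m fl / reg.Zm k).det‖ * (∑ a : Fin 3, ∑ i : Fin 4, ∑ b : Fin 3, ∑ j : Fin 4, ‖(diracMatrix U fun fl => reg.mcrit k + reg.a k * m fl / reg.Zm k)⁻¹ (quarkEquiv (f, (Torus.proj (2 * S + 1) 0, a, i))) (quarkEquiv (f, (Torus.proj (2 * S + 1) (v), b, j)))‖) ^ s ∂(wilsonMeasure (fundamentalRep (Fin 3)) (reg.β k))) / (∫ U : GaugeConfig 4 (2 * S + 1) (Matrix.specialUnitaryGroup (Fin 3) ℂ), ‖(diracMatrix U fun fl => reg.mcrit k + reg.a k * m fl / reg.Zm k).det‖ ∂(wilsonMeasure (fundamentalRep (Fin 3)) (reg.β k))) ≤ C * Real.exp (-(δ * (reg.a k * ‖v‖)))) ∧ (∃ s c₀ C₁ p : ℝ, 0 < s ∧ s < 1 ∧ 0 < c₀ ∧ ∀ᶠ k in atTop, ∀ S : ℕ, reg.L k ≤ S → ∀ (f : Fin Nf) (n : ℕ), n ≤ S → c₀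 * Real.exp (-(C₁ * (reg.a k * n) + p * Real.log (n + 1))) ≤ (∫ U : GaugeConfig 4 (2 * S + 1) (Matrix.specialUnitaryGroup (Fin 3) ℂ), ‖(diracMatrix U fun fl => reg.mcrit k + reg.a k * m fl / reg.Zm k).det‖ * (∑ a : Fin 3, ∑ i : Fin 4, ∑ b : Fin 3, ∑ j : Fin 4, ‖(diracMatrix U fun fl => reg.mcrit k + reg.a k * m fl / reg.Zm k)⁻¹ (quarkEquiv (f, (Torus.proj (2 * S + 1) 0, a, i))) (quarkEquiv (f, (Torus.proj (2 * S + 1) (Pi.single 0 (n : ℤ)), b, j)))‖) ^ s ∂(wilsonMeasure (fundamentalRep (Fin 3)) (reg.β k))) / (∫ U : GaugeConfig 4 (2 * S + 1) (Matrix.specialUnitaryGroup (Fin 3) ℂ), ‖(diracMatrix U fun fl => reg.mcrit k + reg.a k * m fl / reg.Zm k).det‖ ∂(wilsonMeasure (fundamentalRep (Fin 3)) (reg.β k)))) ∧ (∀ᶠ k in atTop, (1 / 2 : ℝ) ≤ ‖∫ U : GaugeConfig 4 (2 * reg.L k + 1) (Matrix.specialUnitaryGroup (Fin 3) ℂ),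 (diracMatrix U fun fl => reg.mcrit k + reg.a k * m fl / reg.Zm k).det ∂(wilsonMeasure (fundamentalRep (Fin 3)) (reg.β k))‖ / (∫ U : GaugeConfig 4 (2 * reg.L k + 1) (Matrix.specialUnitaryGroup (Fin 3) ℂ), ‖(diracMatrix U fun fl => reg.mcrit k + reg.a k * m fl / reg.Zm k).det‖ ∂(wilsonMeasure (fundamentalRep (Fin 3)) (reg.β k))))

/-- item stmt-QuantumFields-9151 · crux · rank 3 · open · by planner
why it might fail: (ii) gives s<1 single-entry moments; the conclusion needs, even at n=0, volume-uniform FIRST moments of r×r minors of G_f (r≥2: baryons) under the non-product |Πdet| weight: a Minami-type bound (known for rank-one site disorder only) plus an eigenfunction-correlator step via independent disorder.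
sources: Weingarten1983, VafaWitten1984NPB, SimsWarzel2016, AzaBruDesiqueirapedra2018, AizenmanWarzel2015, Minami1996
[crux] card K2, phase-quenched and determinantal. For every N_f, every reg : QCDRegularisation N_f
and every m > 0: the UPPER clause of MobilityGap alone implies that there is δ' > 0 such that for
every pair of gauge-invariant local lattice QCD observables A, B (any quark boxes) with A
FLAVOUR-CHARGED (some flavour f₀ and q ≠ 0 with A ↦ e^(iqθ)A under ψ_f₀ ↦ e^(iθ)ψ_f₀, ψ̄_f₀ ↦
e^(−iθ)ψ̄_f₀) there is C' with, for all large k, all S ≥ L_k and n ≤ S, |E_{|w|}[⟨A(0)·B(n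
e₀)⟩_F(U)]| ≤ C' e^(−δ' a_k n), ⟨·⟩_F(U) the Berezin ratio in the background U (charged A has ⟨A⟩_F
≡ 0, so this IS the connected correlator of the phase-quenched ensemble). Mechanism: Wick's theorem
in determinant form — ⟨AB⟩_F·Π_f det D_f is a sum of products of COMPLEMENTARY MINORS of the D_f
(Jacobi), bounded configuration-wise, and flavour charge forces ≥ |q| quark lines of flavour f₀
across the separation in every term; the upgrade from single-entry s<1 moments to first moments of
minors is the lattice analogue of the eigenfunction-correlator / determinantal-decay step of
localisation theory. [deps: MobilityGap] [difficulty: L] -/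
@[route_item "route-QuantumFields-WilsonMobilityGap", crux]
def PhaseQuenchedFlavourDecay : Prop :=
  open MeasureTheory Filter Literature.MathematicalPhysics.QuantumFieldTheory Literature.MathematicalPhysics.QuantumLattice Literature.Probability.LatticeModels in ∀ (Nf : ℕ) (reg : QCDRegularisation Nf) (m : Fin Nf → ℝ), (∀ f, 0 < m f) → (∃ s δ C : ℝ, 0 < s ∧ s < 1 ∧ 0 < δ ∧ ∀ᶠ k in atTop, ∀ S : ℕ, reg.L k ≤ S → ∀ (f : Fin Nf) (v : Literature.Probability.LatticeModels.Site 4), v ∈ box 4 S → (∫ U : GaugeConfig 4 (2 * S + 1) (Matrix.specialUnitaryGroup (Fin 3) ℂ), ‖(diracMatrix U fun fl => reg.mcrit k + reg.a k * m fl / reg.Zm k).det‖ * (∑ a : Fin 3, ∑ i : Fin 4, ∑ b : Fin 3, ∑ j : Fin 4, ‖(diracMatrix U fun fl => reg.mcrit k + reg.a k * m fl / reg.Zm k)⁻¹ (quarkEquiv (f, (Torus.proj (2 * S + 1) 0, a, i))) (quarkEquiv (f, (Torus.proj (2 * S + 1) (v), b, j)))‖) ^ s ∂(wilsonMeasure (fundamentalRep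 (Fin 3)) (reg.β k))) / (∫ U : GaugeConfig 4 (2 * S + 1) (Matrix.specialUnitaryGroup (Fin 3) ℂ), ‖(diracMatrix U fun fl => reg.mcrit k + reg.a k * m fl / reg.Zm k).det‖ ∂(wilsonMeasure (fundamentalRep (Fin 3)) (reg.β k))) ≤ C * Real.exp (-(δ * (reg.a k * ‖v‖)))) → (∃ δ' : ℝ, 0 < δ' ∧ ∀ (R R' : ℕ) (A : QCDLatticeObservable Nf R) (B : QCDLatticeObservable Nf R'), (∃ (f₀ : Fin Nf) (q : ℤ), q ≠ 0 ∧ ∀ (θ : ℝ) (U : LGConfig 4 (Matrix.specialUnitaryGroup (Fin 3) ℂ)), ExteriorAlgebra.map (LinearMap.pi fun w => (Sum.elim (fun i => if (boxQuarkEquiv.symm i).1 = f₀ then Complex.exp (-((θ : ℂ) * Complex.I)) else 1) (fun i => if (boxQuarkEquiv.symm i).1 = f₀ then Complex.exp ((θ : ℂ) * Complex.I) else 1) (ofLex w)) • LinearMap.proj w) (A.F U) = Complex.exp (((q : ℝ) * θ : ℝ) * Complex.I) • A.F U) → ∃ C' : ℝ, ∀ᶠ k in atTop, ∀ S : ℕ,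 reg.L k ≤ S → ∀ n : ℕ, n ≤ S → ‖(∫ U : GaugeConfig 4 (2 * S + 1) (Matrix.specialUnitaryGroup (Fin 3) ℂ), (‖(diracMatrix U fun fl => reg.mcrit k + reg.a k * m fl / reg.Zm k).det‖ : ℂ) * (fermiIntegral (A.onTorus (2 * S + 1) 0 U * B.onTorus (2 * S + 1) (Pi.single 0 (n : ℤ)) U * fermiBoltzmann U fun fl => reg.mcrit k + reg.a k * m fl / reg.Zm k) / fermiIntegral (fermiBoltzmann U fun fl => reg.mcrit k + reg.a k * m fl / reg.Zm k)) ∂(wilsonMeasure (fundamentalRep (Fin 3)) (reg.β k))) / (∫ U : GaugeConfig 4 (2 * S + 1) (Matrix.specialUnitaryGroup (Fin 3) ℂ), (‖(diracMatrix U fun fl => reg.mcrit k + reg.a k * m fl / reg.Zm k).det‖ : ℂ) ∂(wilsonMeasure (fundamentalRep (Fin 3)) (reg.β k)))‖ ≤ C' * Real.exp (-(δ' * (reg.a k * n))))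

/-- item stmt-QuantumFields-17498 · crux · rank 4 · open · by planner
why it might fail: As GluonicCompletion (uniform gluonic clustering at weak coupling, convergent sign-defect expansion, E0–E4, rotations — all open) and now WITHOUT the offset shift: signed = phase-quenched and the continuum limit must hold at the given m_crit for every m>0, arbitrarily close to the chiral line.
sources: JaffeWitten2000, Balaban1988Convergent, OsterwalderSeiler1978, Luscher1977, MohlerSchaefer2020, SeilerLNP1982
[crux] K3 with the chiral pin as INPUT (statement re-type p117723). For N_f ∈ {2,3}: if some reg :
QCDRegularisation N_f has HasMassScaling, reg.IsChiralAtZero, asymptotic scaling and, for every m >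
0, clauses (i)–(iv) of (Chiral)MobilityGap together with the conclusion of PhaseQuenchedFlavourDecay
(flavour-charged phase-quenched decay at rate δ' a_k), then QCDOf N_f holds — i.e. such a CHIRAL,
localised, sign-coherent, flavour-gapped Wilson trajectory can be completed to OS data with
IsQCDAlong, non-trivial non-Gaussian glue, non-decoupled flavour-changing pseudoscalars,
T.HasMassGap Δ and the FULL HasLatticeMassGap Δ for every m > 0, by a witness regularisation that is
itself chiral at zero: the completion may choose z, shift (IsChiralAtZero reads reg.scheme m 0 0
only), keep reg, or pass to a subsequence retaining the chiral witnesses (countably many (ε_j, m_j),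
diagonal choice), but may NO LONGER shift the flavour-blind offset; the signed weight (dilute
sign-defect gas, reweighting ⟨·σ⟩_{|w|}/⟨σ⟩_{|w|}), the flavour-NEUTRAL and gluonic channels
(hairpins, glueballs) and the continuum limit are its content. Text = GluonicCompletion's with
`reg.IsChiralAtZero ∧` inserted after `r -/
@[route_item "route-QuantumFields-WilsonMobilityGap", crux]
def ChiralGluonicCompletion : Prop :=
  open MeasureTheory Filter Literature.MathematicalPhysics.QuantumFieldTheory Literature.MathematicalPhysics.QuantumLattice Literature.Probability.LatticeModels in ∀ Nf : ℕ, Nf = 2 ∨ Nf = 3 → (∃ reg : QCDRegularisation Nf, reg.HasMassScaling ∧ reg.IsChiralAtZero ∧ (reg.scheme 0 0 0).HasAsymptoticScaling ∧ ∀ m : Fin Nf → ℝ, (∀ f, 0 < m f) → ((∀ f : Fin Nf, ∀ᶠ k in atTop, -1 < reg.mcrit k + reg.a k * m f / reg.Zm k) ∧ (∃ s δ C : ℝ, 0 < s ∧ s < 1 ∧ 0 < δ ∧ ∀ᶠ k in atTop, ∀ S : ℕ, reg.L k ≤ S → ∀ (f : Fin Nf) (v : Literature.Probability.LatticeModels.Site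 4), v ∈ box 4 S → (∫ U : GaugeConfig 4 (2 * S + 1) (Matrix.specialUnitaryGroup (Fin 3) ℂ), ‖(diracMatrix U fun fl => reg.mcrit k + reg.a k * m fl / reg.Zm k).det‖ * (∑ a : Fin 3, ∑ i : Fin 4, ∑ b : Fin 3, ∑ j : Fin 4, ‖(diracMatrix U fun fl => reg.mcrit k + reg.a k * m fl / reg.Zm k)⁻¹ (quarkEquiv (f, (Torus.proj (2 * S + 1) 0, a, i))) (quarkEquiv (f, (Torus.proj (2 * S + 1) (v), b, j)))‖) ^ s ∂(wilsonMeasure (fundamentalRep (Fin 3)) (reg.β k))) / (∫ U : GaugeConfig 4 (2 * S + 1) (Matrix.specialUnitaryGroup (Fin 3) ℂ), ‖(diracMatrix U fun fl => reg.mcrit k + reg.a k * m fl / reg.Zm k).det‖ ∂(wilsonMeasure (fundamentalRep (Fin 3)) (reg.β k))) ≤ C * Real.exp (-(δ * (reg.a k * ‖v‖)))) ∧ (∃ s c₀ C₁ p : ℝ, 0 < s ∧ s < 1 ∧ 0 < c₀ ∧ ∀ᶠ k in atTop, ∀ S : ℕ, reg.L k ≤ S → ∀ (f : Fin Nf) (n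 : ℕ), n ≤ S → c₀ * Real.exp (-(C₁ * (reg.a k * n) + p * Real.log (n + 1))) ≤ (∫ U : GaugeConfig 4 (2 * S + 1) (Matrix.specialUnitaryGroup (Fin 3) ℂ), ‖(diracMatrix U fun fl => reg.mcrit k + reg.a k * m fl / reg.Zm k).det‖ * (∑ a : Fin 3, ∑ i : Fin 4, ∑ b : Fin 3, ∑ j : Fin 4, ‖(diracMatrix U fun fl => reg.mcrit k + reg.a k * m fl / reg.Zm k)⁻¹ (quarkEquiv (f, (Torus.proj (2 * S + 1) 0, a, i))) (quarkEquiv (f, (Torus.proj (2 * S + 1) (Pi.single 0 (n : ℤ)), b, j)))‖) ^ s ∂(wilsonMeasure (fundamentalRep (Fin 3)) (reg.β k))) / (∫ U : GaugeConfig 4 (2 * S + 1) (Matrix.specialUnitaryGroup (Fin 3) ℂ), ‖(diracMatrix U fun fl => reg.mcrit k + reg.a k * m fl / reg.Zm k).det‖ ∂(wilsonMeasure (fundamentalRep (Fin 3)) (reg.β k)))) ∧ (∀ᶠ k in atTop, (1 / 2 : ℝ) ≤ ‖∫ U : GaugeConfig 4 (2 * reg.L k + 1) (Matrix.specialUnitaryGroup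 (Fin 3) ℂ), (diracMatrix U fun fl => reg.mcrit k + reg.a k * m fl / reg.Zm k).det ∂(wilsonMeasure (fundamentalRep (Fin 3)) (reg.β k))‖ / (∫ U : GaugeConfig 4 (2 * reg.L k + 1) (Matrix.specialUnitaryGroup (Fin 3) ℂ), ‖(diracMatrix U fun fl => reg.mcrit k + reg.a k * m fl / reg.Zm k).det‖ ∂(wilsonMeasure (fundamentalRep (Fin 3)) (reg.β k))))) ∧ (∃ δ' : ℝ, 0 < δ' ∧ ∀ (R R' : ℕ) (A : QCDLatticeObservable Nf R) (B : QCDLatticeObservable Nf R'), (∃ (f₀ : Fin Nf) (q : ℤ), q ≠ 0 ∧ ∀ (θ : ℝ) (U : LGConfig 4 (Matrix.specialUnitaryGroup (Fin 3) ℂ)), ExteriorAlgebra.map (LinearMap.pi fun w => (Sum.elim (fun i => if (boxQuarkEquiv.symm i).1 = f₀ then Complex.exp (-((θ : ℂ) * Complex.I)) else 1) (fun i => if (boxQuarkEquiv.symm i).1 = f₀ then Complex.exp ((θ : ℂ) * Complex.I) else 1) (ofLex w)) • LinearMap.proj w) (A.F U) = Complex.exp (((q : ℝ) * θ : ℝ)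 * Complex.I) • A.F U) → ∃ C' : ℝ, ∀ᶠ k in atTop, ∀ S : ℕ, reg.L k ≤ S → ∀ n : ℕ, n ≤ S → ‖(∫ U : GaugeConfig 4 (2 * S + 1) (Matrix.specialUnitaryGroup (Fin 3) ℂ), (‖(diracMatrix U fun fl => reg.mcrit k + reg.a k * m fl / reg.Zm k).det‖ : ℂ) * (fermiIntegral (A.onTorus (2 * S + 1) 0 U * B.onTorus (2 * S + 1) (Pi.single 0 (n : ℤ)) U * fermiBoltzmann U fun fl => reg.mcrit k + reg.a k * m fl / reg.Zm k) / fermiIntegral (fermiBoltzmann U fun fl => reg.mcrit k + reg.a k * m fl / reg.Zm k)) ∂(wilsonMeasure (fundamentalRep (Fin 3)) (reg.β k))) / (∫ U : GaugeConfig 4 (2 * S + 1) (Matrix.specialUnitaryGroup (Fin 3) ℂ), (‖(diracMatrix U fun fl => reg.mcrit k + reg.a k * m fl / reg.Zm k).det‖ : ℂ) ∂(wilsonMeasure (fundamentalRep (Fin 3)) (reg.β k)))‖ ≤ C' * Real.exp (-(δ' * (reg.a k * n))))) → QCDOf Nf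

/-- item stmt-QuantumFields-9150 · support · rank 2 · open · by planner
why it might fail: No Wegner/FM input exists for non-abelian Haar links entering H_W non-monotonically (abelian only: ErdosHasler2012); link conditionals sharpen ~e^{cβ_k} as disorder weakens, so the FM criterion may never start; (iv) at physical side a_k(2L_k+1)→∞, one reg for all m: defect density→0 is unproved.
sources: GoltermanShamir2003, GoltermanShamirSvetitsky2005, GoltermanShamirSvetitsky2005MobilityEdge, AizenmanMolchanov1993, AizenmanEtAl2001, Klopp2002
[crux] card K1 made honest. For N_f ∈ {2,3} there is reg : QCDRegularisation N_f with HasMassScaling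
and two-loop asymptotic scaling such that for every m > 0 (componentwise), along m_f(k) = m_crit(k)
+ a_k m_f/Z_m(k): (i) −1 < m_f(k) eventually; (ii) UPPER: ∃ s ∈ (0,1), δ, C > 0 with, for all large
k, all S ≥ L_k, all flavours f and all v ∈ {−S..S}⁴, E_{|w|}[(Σ_{colour,spin}|G_f(0,v)|)^s] ≤ C
e^(−δ a_k ‖v‖∞), where E_{|w|} is the Wilson measure at β_k on the torus of side 2S+1 reweighted by
|det diracMatrix| = Π_f|det D_W(m_f(k))| and G = diracMatrix⁻¹; (iii) LOWER: ∃ s, c₀, C₁, p with c₀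
e^(−C₁ a_k n − p log(n+1)) ≤ E_{|w|}[(Σ|G_f(0, n e₀)|)^s] for n ≤ S (physical, not lattice-scale,
quark masses); (iv) SIGN: for all large k, |∫ det diracMatrix dμ_W| ≥ ½ ∫ |det diracMatrix| dμ_W on
the torus of side 2L_k+1 (sign defects dilute at the scheme's own volume). [difficulty:
open-problem] -/
@[route_item "route-QuantumFields-WilsonMobilityGap", crux]
def MobilityGap : Prop :=
  open MeasureTheory Filter Literature.MathematicalPhysics.QuantumFieldTheory Literature.MathematicalPhysics.QuantumLattice Literature.Probability.LatticeModels in ∀ Nf : ℕ, Nf = 2 ∨ Nf = 3 → ∃ reg : QCDRegularisation Nf, reg.HasMassScaling ∧ (reg.scheme 0 0 0).HasAsymptoticScaling ∧ ∀ m : Fin Nf → ℝ, (∀ f, 0 < m f) → (∀ f : Fin Nf, ∀ᶠ k in atTop, -1 < reg.mcrit k + reg.a k * m f / reg.Zm k) ∧ (∃ s δ C : ℝ, 0 < s ∧ s < 1 ∧ 0 < δ ∧ ∀ᶠ k in atTop, ∀ S : ℕ, reg.L k ≤ S → ∀ (f : Fin Nf) (v : Literature.Probability.LatticeModels.Site 4),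 v ∈ box 4 S → (∫ U : GaugeConfig 4 (2 * S + 1) (Matrix.specialUnitaryGroup (Fin 3) ℂ), ‖(diracMatrix U fun fl => reg.mcrit k + reg.a k * m fl / reg.Zm k).det‖ * (∑ a : Fin 3, ∑ i : Fin 4, ∑ b : Fin 3, ∑ j : Fin 4, ‖(diracMatrix U fun fl => reg.mcrit k + reg.a k * m fl / reg.Zm k)⁻¹ (quarkEquiv (f, (Torus.proj (2 * S + 1) 0, a, i))) (quarkEquiv (f, (Torus.proj (2 * S + 1) (v), b, j)))‖) ^ s ∂(wilsonMeasure (fundamentalRep (Fin 3)) (reg.β k))) / (∫ U : GaugeConfig 4 (2 * S + 1) (Matrix.specialUnitaryGroup (Fin 3) ℂ), ‖(diracMatrix U fun fl => reg.mcrit k + reg.a k * m fl / reg.Zm k).det‖ ∂(wilsonMeasure (fundamentalRep (Fin 3)) (reg.β k))) ≤ C * Real.exp (-(δ * (reg.a k * ‖v‖)))) ∧ (∃ s c₀ C₁ p : ℝ, 0 < s ∧ s < 1 ∧ 0 < c₀ ∧ ∀ᶠ k in atTop, ∀ S : ℕ, reg.L k ≤ S → ∀ (f : Fin Nf) (n :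 ℕ), n ≤ S → c₀ * Real.exp (-(C₁ * (reg.a k * n) + p * Real.log (n + 1))) ≤ (∫ U : GaugeConfig 4 (2 * S + 1) (Matrix.specialUnitaryGroup (Fin 3) ℂ), ‖(diracMatrix U fun fl => reg.mcrit k + reg.a k * m fl / reg.Zm k).det‖ * (∑ a : Fin 3, ∑ i : Fin 4, ∑ b : Fin 3, ∑ j : Fin 4, ‖(diracMatrix U fun fl => reg.mcrit k + reg.a k * m fl / reg.Zm k)⁻¹ (quarkEquiv (f, (Torus.proj (2 * S + 1) 0, a, i))) (quarkEquiv (f, (Torus.proj (2 * S + 1) (Pi.single 0 (n : ℤ)), b, j)))‖) ^ s ∂(wilsonMeasure (fundamentalRep (Fin 3)) (reg.β k))) / (∫ U : GaugeConfig 4 (2 * S + 1) (Matrix.specialUnitaryGroup (Fin 3) ℂ), ‖(diracMatrix U fun fl => reg.mcrit k + reg.a k * m fl / reg.Zm k).det‖ ∂(wilsonMeasure (fundamentalRep (Fin 3)) (reg.β k)))) ∧ (∀ᶠ k in atTop, (1 / 2 : ℝ) ≤ ‖∫ U : GaugeConfig 4 (2 * reg.L k + 1) (Matrix.specialUnitaryGroup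 (Fin 3) ℂ), (diracMatrix U fun fl => reg.mcrit k + reg.a k * m fl / reg.Zm k).det ∂(wilsonMeasure (fundamentalRep (Fin 3)) (reg.β k))‖ / (∫ U : GaugeConfig 4 (2 * reg.L k + 1) (Matrix.specialUnitaryGroup (Fin 3) ℂ), ‖(diracMatrix U fun fl => reg.mcrit k + reg.a k * m fl / reg.Zm k).det‖ ∂(wilsonMeasure (fundamentalRep (Fin 3)) (reg.β k))))

/-- item stmt-QuantumFields-9152 · support · rank 4 · open · by planner
why it might fail: Contains the YM gap: sign coherence comes only at side 2L_k+1 but HasLatticeMassGap needs all S≥L_k, where ⟨σ⟩_|w|~exp(−c(a_kS)^4)→0, so signed ratios need a convergent sign-defect polymer expansion = uniform gluonic clustering at weak coupling (open); plus E0–E4, rotations, non-Gaussian glue.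
sources: JaffeWitten2000, Balaban1988Convergent, OsterwalderSeiler1978, Luscher1977, MohlerSchaefer2020, SeilerLNP1982
[crux] card K3 + UV, the Yang–Mills-hard remainder. For N_f ∈ {2,3}: if some reg : QCDRegularisation
N_f has HasMassScaling, asymptotic scaling and, for every m > 0, clauses (i)–(iv) of MobilityGap
together with the conclusion of PhaseQuenchedFlavourDecay, then QCDOf N_f holds — i.e. such a
localised, sign-coherent, flavour-gapped Wilson trajectory can be completed (passing to
subsequences, shifting the flavour-blind offset, choosing z, shift) to OS data with IsQCDAlong,
non-trivial non-Gaussian glue, non-decoupled flavour-changing pseudoscalars, T.HasMassGap Δ and the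
FULL HasLatticeMassGap Δ: the signed weight (dilute sign-defect gas, reweighting
⟨·σ⟩_{|w|}/⟨σ⟩_{|w|}), the flavour-NEUTRAL and purely gluonic channels (hairpins, glueballs) and the
continuum limit. [deps: MobilityGap, PhaseQuenchedFlavourDecay] [difficulty: open-problem] -/
@[route_item "route-QuantumFields-WilsonMobilityGap"]
def GluonicCompletion : Prop :=
  open MeasureTheory Filter Literature.MathematicalPhysics.QuantumFieldTheory Literature.MathematicalPhysics.QuantumLattice Literature.Probability.LatticeModels in ∀ Nf : ℕ, Nf = 2 ∨ Nf = 3 → (∃ reg : QCDRegularisation Nf, reg.HasMassScaling ∧ (reg.scheme 0 0 0).HasAsymptoticScaling ∧ ∀ m : Fin Nf → ℝ, (∀ f, 0 < m f) → ((∀ f : Fin Nf, ∀ᶠ k in atTop, -1 < reg.mcrit k + reg.a k * m f / reg.Zm k) ∧ (∃ s δ C : ℝ, 0 < s ∧ s < 1 ∧ 0 < δ ∧ ∀ᶠ k in atTop, ∀ S : ℕ, reg.L k ≤ S → ∀ (f : Fin Nf) (v : Literature.Probability.LatticeModels.Site 4), v ∈ box 4 S → (∫ U : GaugeConfig 4 (2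 * S + 1) (Matrix.specialUnitaryGroup (Fin 3) ℂ), ‖(diracMatrix U fun fl => reg.mcrit k + reg.a k * m fl / reg.Zm k).det‖ * (∑ a : Fin 3, ∑ i : Fin 4, ∑ b : Fin 3, ∑ j : Fin 4, ‖(diracMatrix U fun fl => reg.mcrit k + reg.a k * m fl / reg.Zm k)⁻¹ (quarkEquiv (f, (Torus.proj (2 * S + 1) 0, a, i))) (quarkEquiv (f, (Torus.proj (2 * S + 1) (v), b, j)))‖) ^ s ∂(wilsonMeasure (fundamentalRep (Fin 3)) (reg.β k))) / (∫ U : GaugeConfig 4 (2 * S + 1) (Matrix.specialUnitaryGroup (Fin 3) ℂ), ‖(diracMatrix U fun fl => reg.mcrit k + reg.a k * m fl / reg.Zm k).det‖ ∂(wilsonMeasure (fundamentalRep (Fin 3)) (reg.β k))) ≤ C * Real.exp (-(δ * (reg.a k * ‖v‖)))) ∧ (∃ s c₀ C₁ p : ℝ, 0 < s ∧ s < 1 ∧ 0 < c₀ ∧ ∀ᶠ k in atTop, ∀ S : ℕ, reg.L k ≤ S → ∀ (f : Fin Nf) (n : ℕ), n ≤ S → c₀ * Real.exp (-(C₁ *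 (reg.a k * n) + p * Real.log (n + 1))) ≤ (∫ U : GaugeConfig 4 (2 * S + 1) (Matrix.specialUnitaryGroup (Fin 3) ℂ), ‖(diracMatrix U fun fl => reg.mcrit k + reg.a k * m fl / reg.Zm k).det‖ * (∑ a : Fin 3, ∑ i : Fin 4, ∑ b : Fin 3, ∑ j : Fin 4, ‖(diracMatrix U fun fl => reg.mcrit k + reg.a k * m fl / reg.Zm k)⁻¹ (quarkEquiv (f, (Torus.proj (2 * S + 1) 0, a, i))) (quarkEquiv (f, (Torus.proj (2 * S + 1) (Pi.single 0 (n : ℤ)), b, j)))‖) ^ s ∂(wilsonMeasure (fundamentalRep (Fin 3)) (reg.β k))) / (∫ U : GaugeConfig 4 (2 * S + 1) (Matrix.specialUnitaryGroup (Fin 3) ℂ), ‖(diracMatrix U fun fl => reg.mcrit k + reg.a k * m fl / reg.Zm k).det‖ ∂(wilsonMeasure (fundamentalRep (Fin 3)) (reg.β k)))) ∧ (∀ᶠ k in atTop, (1 / 2 : ℝ) ≤ ‖∫ U : GaugeConfig 4 (2 * reg.L k + 1) (Matrix.specialUnitaryGroup (Fin 3) ℂ), (diracMatrix U fun fl =>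 reg.mcrit k + reg.a k * m fl / reg.Zm k).det ∂(wilsonMeasure (fundamentalRep (Fin 3)) (reg.β k))‖ / (∫ U : GaugeConfig 4 (2 * reg.L k + 1) (Matrix.specialUnitaryGroup (Fin 3) ℂ), ‖(diracMatrix U fun fl => reg.mcrit k + reg.a k * m fl / reg.Zm k).det‖ ∂(wilsonMeasure (fundamentalRep (Fin 3)) (reg.β k))))) ∧ (∃ δ' : ℝ, 0 < δ' ∧ ∀ (R R' : ℕ) (A : QCDLatticeObservable Nf R) (B : QCDLatticeObservable Nf R'), (∃ (f₀ : Fin Nf) (q : ℤ), q ≠ 0 ∧ ∀ (θ : ℝ) (U : LGConfig 4 (Matrix.specialUnitaryGroup (Fin 3) ℂ)), ExteriorAlgebra.map (LinearMap.pi fun w => (Sum.elim (fun i => if (boxQuarkEquiv.symm i).1 = f₀ then Complex.exp (-((θ : ℂ) * Complex.I)) else 1) (fun i => if (boxQuarkEquiv.symm i).1 = f₀ then Complex.exp ((θ : ℂ) * Complex.I) else 1) (ofLex w)) • LinearMap.proj w) (A.F U) = Complex.exp (((q : ℝ) * θ : ℝ) * Complex.I) • A.F U) → ∃ C' : ℝ,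 ∀ᶠ k in atTop, ∀ S : ℕ, reg.L k ≤ S → ∀ n : ℕ, n ≤ S → ‖(∫ U : GaugeConfig 4 (2 * S + 1) (Matrix.specialUnitaryGroup (Fin 3) ℂ), (‖(diracMatrix U fun fl => reg.mcrit k + reg.a k * m fl / reg.Zm k).det‖ : ℂ) * (fermiIntegral (A.onTorus (2 * S + 1) 0 U * B.onTorus (2 * S + 1) (Pi.single 0 (n : ℤ)) U * fermiBoltzmann U fun fl => reg.mcrit k + reg.a k * m fl / reg.Zm k) / fermiIntegral (fermiBoltzmann U fun fl => reg.mcrit k + reg.a k * m fl / reg.Zm k)) ∂(wilsonMeasure (fundamentalRep (Fin 3)) (reg.β k))) / (∫ U : GaugeConfig 4 (2 * S + 1) (Matrix.specialUnitaryGroup (Fin 3) ℂ), (‖(diracMatrix U fun fl => reg.mcrit k + reg.a k * m fl / reg.Zm k).det‖ : ℂ) ∂(wilsonMeasure (fundamentalRep (Fin 3)) (reg.β k)))‖ ≤ C' * Real.exp (-(δ' * (reg.a k * n))))) → QCDOf Nf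

/-- item stmt-QuantumFields-8966 · support · rank 9 · open · by planner
sources: Wegner1971, GoltermanShamir2003, doi:10.1007/s00023-012-0177-9, doi:10.1063/1.4959219
[crux] Haar-regularity / landing law (card K3 cleanest form; shared with card
wilson-dirac-mobility-gap): there are C, p such that for every β ≥ 1, every torus side L ≥ 2, every
bare mass m₀ ∈ [−1, 0] and every ε ∈ (0,1], the Wilson-measure expectation of the number of
eigenvalues of the Hermitian Wilson–Dirac operator γ₅D_W(U,m₀,1) in (−ε, ε) is ≤ C(1+β^p)·ε·L⁴ — a
density-of-states bound linear in the window, extensive, and at most POLYNOMIAL in β (the landing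
probability ∝ a of the pricing argument is this bound at ε = c a m/Z). [difficulty: L] -/
@[route_item "route-QuantumFields-WilsonMobilityGap"]
def WegnerEstimate : Prop :=
  open Literature.MathematicalPhysics.QuantumLattice Literature.MathematicalPhysics.QuantumFieldTheory Literature.Probability.LatticeModels in ∃ C p : ℝ, 0 < C ∧ 0 ≤ p ∧ ∀ β : ℝ, 1 ≤ β → ∀ (L : ℕ) [NeZero L], 2 ≤ L → ∀ m₀ ε : ℝ, -1 ≤ m₀ → m₀ ≤ 0 → 0 < ε → ε ≤ 1 → ∫ U, (Multiset.countP (fun z : ℂ => |z.re| < ε) (spinorLift gammaFive * wilsonDirac (fundamentalRep (Fin 3)) U m₀ 1).charpoly.roots : ℝ) ∂(wilsonMeasure (d := 4) (L := L) (fundamentalRep (Fin 3)) β) ≤ C * (1 + β ^ p) * ε * (L : ℝ) ^ 4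

/-- item stmt-QuantumFields-9153 · support · rank 9 · closed · proved by Summit.QuantumFields.QCD.Theorems.supercriticalSignWitness_proof (prover) · by planner
sources: EdwardsHellerNarayananInstanton1998, EdwardsHellerNarayanan1998, Luscher1982Topology
[support] card P1 in finite form (the source of in-gap states and sign defects; records why no
deterministic-gap crux can work): for every bare mass m ∈ (−1, 0) there are a torus and an SU(3)
gauge field on it with Re det D_W(U, m, r=1) < 0 (one real mode of D_W(U,0,1) in (0, |m|): a
sufficiently smooth lattice instanton on a large enough torus; EHN report the first crossing at |m|
= 0.41 for ρ = 2a). Provable by a certified interval computation of one determinant sign per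
m-interval plus continuity, or analytically for large smooth instantons. [difficulty: M] -/
@[route_item "route-QuantumFields-WilsonMobilityGap"]
def SupercriticalSignWitness : Prop :=
  open Literature.MathematicalPhysics.QuantumFieldTheory Literature.MathematicalPhysics.QuantumLattice in ∀ m : ℝ, -1 < m → m < 0 → ∃ (L : ℕ) (U : GaugeConfig 4 (2 * L + 1) (Matrix.specialUnitaryGroup (Fin 3) ℂ)), (fermionDet (wilsonDirac (fundamentalRep (Fin 3)) U m 1)).re < 0

-- `SupercriticalSignWitness` holds: proved by `Summit.QuantumFields.QCD.Theorems.supercriticalSignWitness_proof` (its module imports this route file, so no `_holds` link can be stated here).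

-- earlier Assembly (stmt-QuantumFields-11071, replaced 2026-08-16T23:22:22Z -> stmt-QuantumFields-17563): proved by Summit.QuantumFields.QCD.Theorems.wilsonMobilityGap_assembly_proof @ 74ce86f01d4a — MobilityGap ∧ PhaseQuenchedFlavourDecay ∧ GluonicCompletion → QCD
-- earlier Assembly (stmt-QuantumFields-9154, replaced 2026-08-15T16:48:41Z -> stmt-QuantumFields-11071): retired by None — MobilityGap → PhaseQuenchedFlavourDecay → GluonicCompletion → QCD
/-- item stmt-QuantumFields-17563 · assembly · rank 1 · closed · proved by Summit.QuantumFields.QCD.Theorems.wilsonMobilityGap_assembly_proof @ f1f08346e258 (prover) · by planner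
sources: JaffeWitten2000, GoltermanShamir2003
[assembly] X → QCD with X = ChiralMobilityGap ∧ PhaseQuenchedFlavourDecay ∧ ChiralGluonicCompletion
(the re-pinned thesis Lean line after the statement re-type p117723); QCD = QCDOf 2 ∧ QCDOf 3 is the
sub-problem constant _root_.QCD of Summits/QuantumFields/QCD/Statement.lean; the deciding theorem
closes is the curried form (natively certified, rev 6). Re-prove by REPLACING
Theorems/WilsonMobilityGapAssembly.lean (its current text destructures the old conjunction and
applies the pre-re-type closes, so it no longer compiles): `rintro ⟨h₁, h₂, h₃⟩; exact closes h₁ h₂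
h₃`. -/
@[route_item "route-QuantumFields-WilsonMobilityGap"]
def Assembly : Prop :=
  ChiralMobilityGap ∧ PhaseQuenchedFlavourDecay ∧ ChiralGluonicCompletion → QCD

-- `Assembly` holds: proved by `Summit.QuantumFields.QCD.Theorems.wilsonMobilityGap_assembly_proof` @ f1f08346e258 (its module imports this route file, so no `_holds` link can be stated here).

/-! D-0027 §2.1 — DECIDING THEOREM (planner-authored via `route open/edit --closes-file`; by planner-rrepair-QuantumFields-WilsonMobilityGa-6862f17d-0 2026-08-16T23:20:39Z):
its hypotheses are this route's items and its conclusion the sub-problem Statement (glue_lint), and it elaborates with this file. -/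

/-- Route glue (D-0027 §2.1), re-elaborated after the statement re-type p117723 (`QCDOf` gained the
conjunct `reg.IsChiralAtZero`): the three cruxes imply the sub-problem statement `QCD` by
propositional bookkeeping — `ChiralMobilityGap` supplies, for `N_f = 2, 3`, ONE regularisation with
mass scaling, the CHIRAL PIN `reg.IsChiralAtZero` (honesty pin (v): `m_crit` sits on the chiral
critical line, the lattice gap closes as `m → 0⁺`) and asymptotic scaling together with its per-mass
clauses (i)–(iv); `PhaseQuenchedFlavourDecay` turns clause (ii) into the flavour-charged
phase-quenched decay; `ChiralGluonicCompletion` consumes exactly that pinned package (chirality is an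
INPUT it must preserve, no offset shift) and returns `QCDOf N_f`. -/
@[closes "route-QuantumFields-WilsonMobilityGap"] theorem closes : ChiralMobilityGap → PhaseQuenchedFlavourDecay → ChiralGluonicCompletion → QCD := by
  intro h1 h2 h3
  refine ⟨h3 2 (Or.inl rfl) ?_, h3 3 (Or.inr rfl) ?_⟩
  · obtain ⟨reg, hMS, hCh, hAS, h⟩ := h1 2 (Or.inl rfl)
    exact ⟨reg, hMS, hCh, hAS, fun m hm => ⟨h m hm, h2 2 reg m hm (h m hm).2.1⟩⟩
  · obtain ⟨reg, hMS, hCh, hAS, h⟩ := h1 3 (Or.inr rfl)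
    exact ⟨reg, hMS, hCh, hAS, fun m hm => ⟨h m hm, h2 3 reg m hm (h m hm).2.1⟩⟩

end Summit.QuantumFields.QCD.Theses.WilsonMobilityGap
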